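import Summits.AtomisticToContinuum.BoseEinsteinCondensation.Theorems.BECThomsonPrincipleGaussianDominationCanFreeAnchorOf
import Summits.AtomisticToContinuum.BoseEinsteinCondensation.Theorems.BECThomsonPrincipleGaussianDominationCanModeBessel
import Summits.AtomisticToContinuum.BoseEinsteinCondensation.Theorems.BECThomsonPrincipleGaussianDominationCanThetaNorm
import HarnessLib

/-!
# The free instance of `GaussianDominationCan`, settled: `T = 0` Gaussian domination for the ideal Bose gas
# with the sharp constant

Route `BECThomsonPrinciple`, crux `GaussianDominationCan` (stmt-AtomisticToContinuum-9479), line `coupling-monotone-chord`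
(lead), registered stub `stub_freeCase`.  Supports (does not close) the item.

For the FREE gas `v = 0` the crux's chord inequality holds with the sharp constant `C = 1/(4π²)` for EVERY particle number
`N ≥ 1`, side `L > 0`, lattice momentum `n ≠ 0`, source strength `s ≥ 0` and periodic Bose trial state — hence
`GDCanWith ρ₀ (1/(4π²)) N₀ 0 M` for every `ρ₀, N₀, M` (no window and no density condition are needed).  This is the
composition of the three landed stubs A1 `stub_modeBessel` (one-mode gradient Bessel + Bose symmetry), A2 `stub_thetaNorm`
(Bose counting `N‖Θ‖² ≤ 1`) and A3 `stub_freeAnchorOf`; the constant is the least possible one by the landed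
`Negative.free_const_ge` / `not_gaussianDominationCan_sharp`.  In operator language: `k²Λ_k†Λ_k − s(Λ_k + Λ_k†) ≥ −s²/k²`
with `Λ_k†Λ_k = n_k ≤ T/k²` (Lewin–Nam–Serfaty–Solovej excitation operator, arXiv:1211.2778). [folklore]
-/

noncomputable section

namespace Summit.AtomisticToContinuum.BoseEinsteinCondensation.Cruxes.GaussianDominationCan.CouplingMonotoneChord

open scoped ENNReal
open Literature.MathematicalPhysics.QuantumManyBody.BoseGas
open Summit.AtomisticToContinuum.BoseEinsteinCondensation.Theorems.GaussianDominationCan.Negative (GDIneq GDCanWith)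

/-- **Registered stub `stub_freeCase`: the free instance of the crux with the sharp constant.**  For `v = 0`, every
`m`, `L > 0`, `n ≠ 0`, `s ≥ 0` and every periodic Bose trial state `Φ`:
`E₀(0) + s·2N|I(Φ)| ≤ T(Φ) + s²L²/(4π²‖n‖∞²)` — i.e. `GDIneq 0 m L n (1/(4π²)) s Φ`. [folklore] -/
theorem stub_freeCase :
    ∀ m : ℕ, ∀ L : ℝ, 0 < L → ∀ n : Fin 3 → ℤ, n ≠ 0 → ∀ s : ℝ, 0 ≤ s →
      ∀ Φ : PeriodicTrialState (m + 1) L, GDIneq 0 m L n (1 / (4 * Real.pi ^ 2)) s Φ :=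
  stub_freeAnchorOf stub_modeBessel stub_thetaNorm

/-- The free instance in the crux's `GDCanWith` form: `GDCanWith ρ₀ (1/(4π²)) N₀ 0 M` for every `ρ₀, N₀, M`. [folklore] -/
theorem gdCanWith_free (ρ₀ : ℝ) (N₀ : ℕ) (M : ℝ) : GDCanWith ρ₀ (1 / (4 * Real.pi ^ 2)) N₀ 0 M :=
  fun m _ L hL _ n hn _ s hs Φ => stub_freeCase m L hL n hn s hs Φ

end Summit.AtomisticToContinuum.BoseEinsteinCondensation.Cruxes.GaussianDominationCan.CouplingMonotoneChord

end
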